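import Summits.SmoothPoincare4.SmoothPoincare4.Theorems.CylinderEntropyCylinderRungTwoRelaxationOfAreaToFloor
import Literature.Geometry.Riemannian.SphericalCylinderEntropy
import Literature.Geometry.Riemannian.SphericalCylinderEntropySmallScales
import HarnessLib

/-!
# Route `CylinderEntropy`, crux `CylinderRungTwo` (stmt-SmoothPoincare4-7631), line `killing-flux`:
# the zonal smoothing on `S⁴` relaxes to the mean as `t → ∞`, uniformly
# (registered helper `helper_heatSmoothingLargeTime`, step S3c of the area-quantization plan r10)

For the typed zonal heat-kernel series `𝔥(t, s) = zonal t s` of the round `S⁴`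
(`Literature.Geometry.Riemannian.SphericalCylinderEntropy`), a continuous `g : ℝ⁵ → ℝ` and
`ε > 0`, there is `t₀ > 0` such that for all `t ≥ t₀` and all `w ∈ ℝ⁵` with `‖w‖ ≤ 1`

  `|∫_{S⁴} 𝔥(t, ∑ᵢ wᵢyᵢ) g(y) dμH⁴(y) - ∫_{S⁴} g dμH⁴| ≤ ε`.

Proof (elementary, large scales only).  For `t ≥ 1` and `|s| ≤ 1` the two landed one-sided
bounds `one_sub_tail_le_zonal` (tree) and `zonal_le_one_add_tail` (`…RelaxationOfAreaToFloor`)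
give `|𝔥(t, s) - 1| ≤ t(t)`, `t(τ) = e^{-τ}/(1 - e^{-τ}) → 0` (`tendsto_tail_atTop`).  On the
sphere `|∑ wᵢyᵢ| ≤ ‖w‖ ‖y‖ ≤ 1` (Cauchy–Schwarz), `g` is bounded by some `G` on the compact `S⁴`,
both integrands are continuous on `S⁴` (the zonal factor by the tree's `continuousOn_zonal` on
`[-1, 1]`), hence integrable on the finite-measure set `S⁴` (`μH⁴(S⁴) < ∞`), and

  `|∫_{S⁴} 𝔥 g - ∫_{S⁴} g| = |∫_{S⁴} (𝔥 - 1) g| ≤ t(t) · G · μH⁴(S⁴) ≤ ε`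

once `t(t) ≤ ε / (G (μH⁴(S⁴) + 1))`, which holds for all large `t`.

* `HeatSmoothingLargeTime.abs_zonal_sub_one_le_tail` — `|𝔥(τ, s) - 1| ≤ t(τ)` (`τ ≥ 1`, `|s| ≤ 1`);
* `HeatSmoothingLargeTime.sum_sq_eq_one_of_mem_sphere`,
  `HeatSmoothingLargeTime.abs_sum_mul_le_one` — `∑ yᵢ² = 1` and `|∑ wᵢyᵢ| ≤ 1` on the sphere;
* `HeatSmoothingLargeTime.continuousOn_zonal_sum_mul` — continuity of the integrand on `S⁴`;
* `helper_heatSmoothingLargeTime` — the registered helper, verbatim.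

Everything here is PROVED (no `sorry`, no new definitions, no named facts).

References: the kernel bounds are elementary (NIST DLMF §18.5.10 majorants as in the tree file);
the statement is the `t → ∞` half of the heat-semigroup argument on `S⁴` (E. B. Davies, *Heat kernels
and spectral theory* (1989), Ch. 5, for context only).
-/

noncomputable section

-- the prescribed namespace `Summit.SmoothPoincare4.SmoothPoincare4.…` repeats `SmoothPoincare4`
set_option linter.dupNamespace false

open MeasureTheory Set Filter
open scoped Manifold ContDiff ENNReal NNReal Topology BigOperators

namespace Summit.SmoothPoincare4.SmoothPoincare4.Cruxes.CylinderRungTwo.KillingFlux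

open Literature.Geometry.Riemannian
open Literature.Geometry.Riemannian.SphericalCylinderEntropy

namespace HeatSmoothingLargeTime

/-- Two-sided large-scale bound of the typed zonal kernel: `|𝔥(τ, s) - 1| ≤ t(τ)` for `τ ≥ 1`,
`|s| ≤ 1` (the tree's `one_sub_tail_le_zonal` and the landed `zonal_le_one_add_tail`). [folklore] -/
theorem abs_zonal_sub_one_le_tail {τ s : ℝ} (hτ : 1 ≤ τ) (hs : |s| ≤ 1) :
    |zonal τ s - 1| ≤ tail τ := by
  rw [abs_sub_le_iff]
  exact ⟨by linarith [zonal_le_one_add_tail hτ hs], by linarith [one_sub_tail_le_zonal hτ hs]⟩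

/-- Points of the unit sphere of `ℝ⁵` satisfy `∑ᵢ yᵢ² = 1`. [folklore] -/
theorem sum_sq_eq_one_of_mem_sphere {y : EuclideanSpace ℝ (Fin 5)}
    (hy : y ∈ Metric.sphere (0 : EuclideanSpace ℝ (Fin 5)) 1) : ∑ i : Fin 5, y i ^ 2 = 1 := by
  have h := EuclideanSpace.real_norm_sq_eq y
  rw [mem_sphere_zero_iff_norm.1 hy, one_pow] at h
  exact h.symm

/-- Cauchy–Schwarz on the sphere: `|∑ wᵢyᵢ| ≤ 1` for `‖w‖ ≤ 1` and `y ∈ S⁴`. [folklore] -/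
theorem abs_sum_mul_le_one {w y : EuclideanSpace ℝ (Fin 5)} (hw : ‖w‖ ≤ 1)
    (hy : y ∈ Metric.sphere (0 : EuclideanSpace ℝ (Fin 5)) 1) : |∑ i : Fin 5, w i * y i| ≤ 1 := by
  have hw2 : ∑ i : Fin 5, w i ^ 2 ≤ 1 := by
    rw [← EuclideanSpace.real_norm_sq_eq]
    exact pow_le_one₀ (norm_nonneg _) hw
  have h := Finset.sum_mul_sq_le_sq_mul_sq Finset.univ (fun i : Fin 5 => w i) (fun i : Fin 5 => y i)
  simp only [sum_sq_eq_one_of_mem_sphere hy, mul_one] at h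
  rw [← sq_le_one_iff_abs_le_one]
  exact h.trans hw2

/-- The smoothing integrand `y ↦ 𝔥(t, ∑ wᵢyᵢ) g(y)` is continuous on `S⁴` for `t > 0`, `‖w‖ ≤ 1`
and `g` continuous (the zonal factor through `continuousOn_zonal` on `[-1, 1]`). [folklore] -/
theorem continuousOn_zonal_sum_mul {t : ℝ} (ht : 0 < t) {w : EuclideanSpace ℝ (Fin 5)}
    (hw : ‖w‖ ≤ 1) {g : EuclideanSpace ℝ (Fin 5) → ℝ} (hg : Continuous g) :
    ContinuousOn (fun y : EuclideanSpace ℝ (Fin 5) => zonal t (∑ i : Fin 5, w i * y i) * g y)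
      (Metric.sphere (0 : EuclideanSpace ℝ (Fin 5)) 1) := by
  refine ContinuousOn.mul ?_ hg.continuousOn
  have hlin : Continuous fun y : EuclideanSpace ℝ (Fin 5) => ∑ i : Fin 5, w i * y i := by fun_prop
  refine (continuousOn_zonal ht).comp hlin.continuousOn fun y hy => ?_
  exact abs_le.1 (abs_sum_mul_le_one hw hy)

end HeatSmoothingLargeTime

open HeatSmoothingLargeTime

/-- **Registered helper `helper_heatSmoothingLargeTime` of line `killing-flux` (step S3c of the
area-quantization plan: the zonal smoothing on `S⁴` converges to the mean as `t → ∞`, uniformly in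
the centre).** For `g : ℝ⁵ → ℝ` continuous and `ε > 0` there is `t₀ > 0` with
`|∫_{S⁴} 𝔥(t, ∑ᵢ wᵢyᵢ) g(y) dμH⁴ - ∫_{S⁴} g dμH⁴| ≤ ε` for all `t ≥ t₀`, `‖w‖ ≤ 1`:
`|𝔥(t, ·) - 1| ≤ t(t) → 0` on `[-1, 1]`, `g` bounded on the compact sphere of finite `μH⁴`-measure.
[folklore] -/
theorem helper_heatSmoothingLargeTime : ∀ g : EuclideanSpace ℝ (Fin 5) → ℝ, Continuous g → ∀ ε : ℝ, 0 < ε → ∃ t₀ : ℝ, 0 < t₀ ∧ ∀ t : ℝ, t₀ ≤ t → ∀ w : EuclideanSpace ℝ (Fin 5), ‖w‖ ≤ 1 → |(∫ y in Metric.sphere (0 : EuclideanSpace ℝ (Fin 5)) 1, Literature.Geometry.Riemannian.SphericalCylinderEntropy.zonal t (∑ i : Fin 5, w i * y i) * g y ∂(μH[4] : Measure (EuclideanSpace ℝ (Fin 5)))) - ∫ y in Metric.sphere (0 : EuclideanSpace ℝ (Fin 5)) 1, g y ∂(μH[4] : Measure (EuclideanSpace ℝ (Fin 5)))| ≤ ε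 := by
  intro g hg ε hε
  set S : Set (EuclideanSpace ℝ (Fin 5)) := Metric.sphere (0 : EuclideanSpace ℝ (Fin 5)) 1 with hS
  -- the sphere: compact, measurable, of finite `μH⁴`-measure
  have hSc : IsCompact S := isCompact_sphere _ _
  have hSm : MeasurableSet S := Metric.isClosed_sphere.measurableSet
  have hSlt : (μH[4] : Measure (EuclideanSpace ℝ (Fin 5))) S < ⊤ := hausdorffMeasure_sphere_four_lt_top
  set V : ℝ := (μH[4] : Measure (EuclideanSpace ℝ (Fin 5))).real S with hV
  have hV0 : 0 ≤ V := measureReal_nonneg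
  -- `g` is bounded on the sphere
  obtain ⟨G₀, hG₀⟩ := hSc.exists_bound_of_continuousOn hg.continuousOn
  set G : ℝ := max G₀ 1 with hGdef
  have hG1 : 1 ≤ G := le_max_right _ _
  have hG0 : 0 < G := lt_of_lt_of_le one_pos hG1
  have hG : ∀ y ∈ S, ‖g y‖ ≤ G := fun y hy => (hG₀ y hy).trans (le_max_left _ _)
  -- the target size of the tail
  set δ : ℝ := ε / (G * (V + 1)) with hδ
  have hGV : 0 < G * (V + 1) := mul_pos hG0 (by linarith)
  have hδ0 : 0 < δ := div_pos hε hGV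
  have hδε : δ * G * (V + 1) = ε := by
    rw [hδ, mul_assoc, div_mul_cancel₀ _ hGV.ne']
  -- the tail is eventually `≤ δ`
  obtain ⟨a, ha⟩ := Filter.eventually_atTop.1 (tendsto_tail_atTop.eventually_le_const hδ0)
  refine ⟨max a 1, lt_of_lt_of_le one_pos (le_max_right _ _), fun t ht w hw => ?_⟩
  have ht1 : 1 ≤ t := (le_max_right a 1).trans ht
  have ht0 : 0 < t := lt_of_lt_of_le one_pos ht1
  have htail : tail t ≤ δ := ha t ((le_max_left a 1).trans ht)
  -- integrability of both integrands on the sphere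
  have hint1 : IntegrableOn
      (fun y : EuclideanSpace ℝ (Fin 5) => zonal t (∑ i : Fin 5, w i * y i) * g y) S
      (μH[4] : Measure (EuclideanSpace ℝ (Fin 5))) :=
    (continuousOn_zonal_sum_mul ht0 hw hg).integrableOn_of_subset_isCompact hSc hSm Subset.rfl
      hSlt.ne
  have hint2 : IntegrableOn g S (μH[4] : Measure (EuclideanSpace ℝ (Fin 5))) :=
    hg.continuousOn.integrableOn_of_subset_isCompact hSc hSm Subset.rfl hSlt.ne
  -- the difference is the integral of `(𝔥 - 1) g`
  have hsub : (∫ y in S, zonal t (∑ i : Fin 5, w i * y i) * g y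
        ∂(μH[4] : Measure (EuclideanSpace ℝ (Fin 5))))
      - ∫ y in S, g y ∂(μH[4] : Measure (EuclideanSpace ℝ (Fin 5)))
      = ∫ y in S, (zonal t (∑ i : Fin 5, w i * y i) - 1) * g y
          ∂(μH[4] : Measure (EuclideanSpace ℝ (Fin 5))) := by
    rw [← integral_sub hint1 hint2]
    refine integral_congr_ae (ae_of_all _ fun y => ?_)
    simp only [sub_mul, one_mul]
  -- pointwise bound of the new integrand on the sphere
  have hbound : ∀ y ∈ S, ‖(zonal t (∑ i : Fin 5, w i * y i) - 1) * g y‖ ≤ δ * G := fun y hy => by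
    rw [norm_mul, Real.norm_eq_abs]
    have h1 : |zonal t (∑ i : Fin 5, w i * y i) - 1| ≤ δ :=
      (abs_zonal_sub_one_le_tail ht1 (abs_sum_mul_le_one hw hy)).trans htail
    exact mul_le_mul h1 (hG y hy) (norm_nonneg _) hδ0.le
  rw [hsub]
  calc |∫ y in S, (zonal t (∑ i : Fin 5, w i * y i) - 1) * g y
          ∂(μH[4] : Measure (EuclideanSpace ℝ (Fin 5)))|
      = ‖∫ y in S, (zonal t (∑ i : Fin 5, w i * y i) - 1) * g y
          ∂(μH[4] : Measure (EuclideanSpace ℝ (Fin 5)))‖ := (Real.norm_eq_abs _).symm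
    _ ≤ δ * G * V := norm_setIntegral_le_of_norm_le_const hSlt hbound
    _ ≤ δ * G * (V + 1) := by
        have : 0 ≤ δ * G := mul_nonneg hδ0.le hG0.le
        nlinarith
    _ = ε := hδε

end Summit.SmoothPoincare4.SmoothPoincare4.Cruxes.CylinderRungTwo.KillingFlux

end
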